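import Mathlib
import Summits.ResolutionOfSingularities.ResolutionOfSingularities.Theorems.WeightedInvariantLocalWeightedDropNCBranchPrimesReading
import Summits.ResolutionOfSingularities.ResolutionOfSingularities.Theorems.WeightedInvariantLocalWeightedDropTOT2CurveSwap

/-!
# `LocalWeightedDrop`, TOT2-LINE regime (P), piece (β-prime) — the SWAPPED label: squarefreeness of the germ and finiteness of the `u₂`-graph data

Crux item stmt-ResolutionOfSingularities-8899 `WeightedInvariant.LocalWeightedDrop` (route `ResolutionOfSingularities/WeightedInvariant`), ENGINE
skeleton v33 (35b29332b4d99231), registered stub `stub_regimePresented`, piece (P3) (res-type-088's conflict budget sums over the u₁-graph data of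
the label `A` AND over the u₁-graph data of the SWAPPED label `j ↦ A_j(u₂,u₁)` = the `u₂`-graphs of `A`, …TOT2CurveSwap; NAMING res-type-088
2026-08-27T16:46:34Z (3)/(4)).  [OURS · L1 W4.3 · chain w43 · seat res-L1-w43-stub-1 gen 6; def-free; `…NCBranchPrimesReading` (`finite_graphData`,
`exists_inverse_ringHom`) + `NCPoly.subst_extendLast_monicGerm`; nothing here is a statement of any manuscript; AI-produced, gate-checked, weaker than
expert review.]

* `isUnit_det_linMat_swap` — the plane swap `![X 1, X 0]` has invertible linear part;
* `subst_extendLast_swap_monicGerm` — the swap of `k⟦u₁,u₂,y⟧` (fixing `y`) carries `monicGerm d A` to the germ of the swapped label;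
* `squarefree_map_of_inverse` — squarefreeness passes through a ring endomorphism with a two-sided inverse;
* **`squarefree_monicGerm_swap`** — `Squarefree (monicGerm d A) → Squarefree (monicGerm d (j ↦ A_j(u₂,u₁)))`;
* **`finite_graphData_swap`** — for a label with squarefree germ (`d ≥ 2`, `k` perfect of characteristic `p`) the u₁-graph data of the swapped
  label — i.e. the `u₂`-graph data of `A` — form a finite set.
-/

set_option linter.dupNamespace false -- mandated namespace of this single-conjunct summit

noncomputable section

namespace Summit.ResolutionOfSingularities.ResolutionOfSingularities.Theorems

namespace NCBranchPrimes

open MvPowerSeries PolyDescent MonicDescent WildMonic NCPoly Literature.AlgebraicGeometry.Resolution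

variable {k : Type} [Field k]

/-- The plane swap has linear part of determinant `−1`. -/
theorem isUnit_det_linMat_swap : IsUnit (FormalCoordChange.linMat (![X 1, X 0] : Fin 2 → MvPowerSeries (Fin 2) k)).det := by
  have hentry : ∀ i j : Fin 2, FormalCoordChange.linMat (![X 1, X 0] : Fin 2 → MvPowerSeries (Fin 2) k) i j = if i = j then 0 else 1 := by
    intro i j
    rw [FormalCoordChange.linMat, Matrix.of_apply]
    fin_cases i <;> fin_cases j <;> simp [coeff_X, Finsupp.single_eq_single_iff]
  rw [Matrix.det_fin_two, hentry, hentry, hentry, hentry]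
  simp

/-- The swap of `k⟦u₁,u₂,y⟧` fixing `y` carries `monicGerm d A` to the germ of the swapped label. -/
theorem subst_extendLast_swap_monicGerm (d : ℕ) (A : Fin d → MvPowerSeries (Fin 2) k) :
    subst (extendLast (![X 1, X 0] : Fin 2 → MvPowerSeries (Fin 2) k)) (monicGerm d A) =
      monicGerm d (fun j => subst (![X 1, X 0] : Fin 2 → MvPowerSeries (Fin 2) k) (A j)) :=
  subst_extendLast_monicGerm _ TOT2Curve.constantCoeff_swapFamily d A

/-- Squarefreeness passes through a ring endomorphism `σ` with a two-sided inverse `τ`. -/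
theorem squarefree_map_of_inverse {R : Type*} [CommRing R] (σ τ : R →+* R) (hτσ : ∀ x, τ (σ x) = x) (hστ : ∀ x, σ (τ x) = x) {b : R}
    (hb : Squarefree b) : Squarefree (σ b) := by
  intro y hy
  have h1 : τ y * τ y ∣ b := by
    have h2 := map_dvd τ hy
    rwa [map_mul, hτσ] at h2
  have h3 := (hb (τ y) h1).map σ
  rwa [hστ] at h3

/-- **SQUAREFREENESS OF THE GERM IS SWAP-INVARIANT**: `Squarefree (monicGerm d A) → Squarefree (monicGerm d (j ↦ A_j(u₂,u₁)))`. -/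
theorem squarefree_monicGerm_swap {d : ℕ} {A : Fin d → MvPowerSeries (Fin 2) k} (hsq : Squarefree (monicGerm d A)) :
    Squarefree (monicGerm d (fun j => subst (![X 1, X 0] : Fin 2 → MvPowerSeries (Fin 2) k) (A j))) := by
  have h0 : ∀ i, constantCoeff (extendLast (![X 1, X 0] : Fin 2 → MvPowerSeries (Fin 2) k) i) = 0 :=
    constantCoeff_extendLast' _ TOT2Curve.constantCoeff_swapFamily
  have hdet : IsUnit (FormalCoordChange.linMat (extendLast (![X 1, X 0] : Fin 2 → MvPowerSeries (Fin 2) k))).det := by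
    rw [det_linMat_extendLast]
    exact isUnit_det_linMat_swap
  obtain ⟨τ, hτσ, hστ⟩ := exists_inverse_ringHom h0 hdet
  have hS : HasSubst (extendLast (![X 1, X 0] : Fin 2 → MvPowerSeries (Fin 2) k)) := hasSubst_of_constantCoeff_zero h0
  have h1 := squarefree_map_of_inverse (substAlgHom hS).toRingHom τ (fun x => by
    change τ ((substAlgHom hS) x) = x
    rw [coe_substAlgHom hS]
    exact hτσ x) (fun x => by
    change (substAlgHom hS) (τ x) = x
    rw [coe_substAlgHom hS]
    exact hστ x) hsq
  change Squarefree ((substAlgHom hS) (monicGerm d A)) at h1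
  rwa [coe_substAlgHom hS, subst_extendLast_swap_monicGerm] at h1

/-- **FINITELY MANY `u₂`-GRAPH DATA.**  For a label `A : Fin d → k⟦u₁,u₂⟧` (`d ≥ 2`) with squarefree germ over a perfect field of characteristic
`p`, the u₁-graph data of the swapped label `j ↦ A_j(u₂,u₁)` (res-type-088's currency for the `u₂`-graphs of `A`, …TOT2CurveSwap) form a
finite set. -/
theorem finite_graphData_swap (p : ℕ) [Fact p.Prime] [CharP k p] [PerfectRing k p] {d : ℕ} (hd : 2 ≤ d)
    (A : Fin d → MvPowerSeries (Fin 2) k) (hsq : Squarefree (monicGerm d A)) :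
    Set.Finite {g : MvPowerSeries (Fin 2) k | (∀ e : Fin 2 →₀ ℕ, e 1 ≠ 0 → coeff e g = 0) ∧
      ∃ ψ : MvPowerSeries (Fin 2) k, constantCoeff ψ = 0 ∧
        IsPermissibleTwoT d (shift d (shearT g (fun j => subst (![X 1, X 0] : Fin 2 → MvPowerSeries (Fin 2) k) (A j))) ψ)} :=
  finite_graphData p hd _ (squarefree_monicGerm_swap hsq)

end NCBranchPrimes

end Summit.ResolutionOfSingularities.ResolutionOfSingularities.Theorems

end
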